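import Summits.Ventures.PackingBounds.Energy.UniversalOptimalityPolygonTable
import Literature.Analysis.Calculus.AbsolutelyMonotonePowerSeries

/-!
# Universal optimality of the regular `N`-gon, every `N` — Cohn–Kumar 2007, Table 1, first row

Framing: lottery ticket; floor = certified bounds/negative ranges. Venture `PackingBounds` (cell
`pub-packcert`, seat `pub-packcert-energy`), energy-minimisation family, `n = 2`. The tree held the rows
`N = 3, 4, 5, 6` (`UniversalOptimalityPolygon3…6.lean`, numerical certificates); this file proves the row for
EVERY `N ≥ 2` at once, from the structural certificate of `UniversalOptimalityPolygonTable` (positive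
definiteness of the partial products by the sine–Gaussian-binomial expansion, design identities from the
vanishing of the full-period cosine sums) fed to `NewtonCert.energy_ge_circle`.

**Theorems.** For every `N ≥ 2`, every configuration of `N` unit vectors of `ℝ²` has, for every `k`,
`Σ_{x ≠ y} (1 + ⟨x,y⟩)^k ≥ N Σ_{l=1}^{N-1} (1 + cos(2πl/N))^k` (the regular `N`-gon's value, `ckPow_energy_ge`);
hence `Σ_{x ≠ y} a(⟨x,y⟩) ≥ N Σ_{l=1}^{N-1} a(cos(2πl/N))` for every `a = Σ c_k (1+t)^k`, `c_k ≥ 0`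
(`universally_optimal`) and for every `a` absolutely monotonic on `[-1,1)` (`universallyOptimal_of_absolutelyMonotoneOn`,
Cohn–Kumar's Theorem 1.2 for `S¹`).

## References
* H. Cohn, A. Kumar, *Universally optimal distribution of points on spheres*, J. Amer. Math. Soc. 20 (2007)
  99–148, Thm. 1.2 and Table 1 (first row). [`CohnKumar2006`]
-/

noncomputable section

namespace Summit.Ventures.PackingBounds.Energy

open Finset Polynomial.Chebyshev Literature.Analysis.Calculus

namespace UniversalPolygon

/-- The sum over the `N`-gon's distance distribution, `Σ_{i<m} mult_i g(v_i - 1)`, is `Σ_{l=1}^{N-1} g(cos(2πl/N))`.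
[folklore] -/
theorem sum_mult_node {N : ℕ} (hN : 2 ≤ N) (g : ℝ → ℝ) :
    ∑ i ∈ range (N / 2), mult N i * g (node N i - 1) =
      ∑ l ∈ range (N - 1), g (Real.cos (2 * Real.pi * ((l + 1 : ℕ) : ℝ) / N)) := by
  have hreg := regroup hN g
  rw [show range N = range (N - 1 + 1) by rw [Nat.sub_add_cancel (by omega)], Finset.sum_range_succ'] at hreg
  simp only [Nat.cast_zero, mul_zero, zero_div, Real.cos_zero] at hreg
  have hnode : ∀ i ∈ range (N / 2), node N i - 1 = Real.cos (2 * Real.pi * ((N / 2 - i : ℕ) : ℝ) / N) := by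
    intro i hi
    rw [node, Nat.mod_eq_of_lt (Finset.mem_range.1 hi), ← neg_cos_psi N i (Finset.mem_range.1 hi)]; ring
  rw [Finset.sum_congr rfl fun i hi => by rw [hnode i hi]]
  linarith

open scoped Classical in
/-- **Theorem A** (regular `N`-gon, all `N ≥ 2`, all `k`): every `N`-point configuration on `S¹` has
`Σ_{x ≠ y} (1 + ⟨x,y⟩)^k ≥ N Σ_{l=1}^{N-1} (1 + cos(2πl/N))^k`. [cite: CohnKumar2006, Theorem 1.2 and Table 1] -/
theorem ckPow_energy_ge {N : ℕ} (hN : 2 ≤ N) (k : ℕ) (C : Finset (EuclideanSpace ℝ (Fin 2)))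
    (h1 : ∀ x ∈ C, ‖x‖ = 1) (hC : C.card = N) :
    (N : ℝ) * ∑ l ∈ range (N - 1), (1 + Real.cos (2 * Real.pi * ((l + 1 : ℕ) : ℝ) / N)) ^ k ≤
      ∑ x ∈ C, ∑ y ∈ C.erase x, (1 + inner ℝ x y) ^ k := by
  have hN0 : 0 < N := by omega
  have key := NewtonCert.energy_ge_circle (N / 2 + N / 2) (by omega) (node N) (node_nonneg N)
    (fun u _ => NewtonCert.omega_doubled_nonneg (node N) (N / 2) (fun i _ => node_add N i) u)
    (G N) (G_nonneg hN0) (fun j hj t => omega_eq hj t) N (N / 2) (by omega) (mult N)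
    (fun j hj => design hN hj) k C h1 hC
  refine le_trans (le_of_eq ?_) key
  rw [← sum_mult_node hN (fun s => (1 + s) ^ k)]
  refine congrArg _ (Finset.sum_congr rfl fun i _ => ?_)
  ring_nf

open scoped Classical in
/-- **Theorem B** (regular `N`-gon, power-series potentials): `Σ_{x ≠ y} a(⟨x,y⟩) ≥ N Σ_{l=1}^{N-1} a(cos(2πl/N))`
for `a(s) = Σ_k c_k (1+s)^k`, `c_k ≥ 0`. [cite: CohnKumar2006, Theorem 1.2] -/
theorem universally_optimal {N : ℕ} (hN : 2 ≤ N) (a : ℝ → ℝ) (c : ℕ → ℝ) (hc : ∀ k, 0 ≤ c k)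
    (ha : ∀ s : ℝ, -1 ≤ s → s < 1 → HasSum (fun k => c k * (1 + s) ^ k) (a s))
    (C : Finset (EuclideanSpace ℝ (Fin 2))) (h1 : ∀ x ∈ C, ‖x‖ = 1) (hC : C.card = N) :
    (N : ℝ) * ∑ l ∈ range (N - 1), a (Real.cos (2 * Real.pi * ((l + 1 : ℕ) : ℝ) / N)) ≤
      ∑ x ∈ C, ∑ y ∈ C.erase x, a (inner ℝ x y) := by
  have hN0 : (0 : ℝ) < N := by exact_mod_cast (show 0 < N by omega)
  have ht : ∀ i < N / 2, -1 ≤ node N i - 1 ∧ node N i - 1 < 1 := by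
    intro i hi
    rw [node, Nat.mod_eq_of_lt hi, show 1 - Real.cos (psi N i) - 1 = -Real.cos (psi N i) by ring, neg_cos_psi N i hi]
    refine ⟨Real.neg_one_le_cos _, lt_of_le_of_ne (Real.cos_le_one _) fun h => ?_⟩
    have hpos : 0 < 2 * Real.pi * ((N / 2 - i : ℕ) : ℝ) / N := by
      have : (0 : ℝ) < ((N / 2 - i : ℕ) : ℝ) := by exact_mod_cast (show 0 < N / 2 - i by omega)
      positivity
    have hlt : 2 * Real.pi * ((N / 2 - i : ℕ) : ℝ) / N < 2 * Real.pi := by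
      rw [div_lt_iff₀ hN0]
      have : ((N / 2 - i : ℕ) : ℝ) < N := by exact_mod_cast (show N / 2 - i < N by omega)
      nlinarith [Real.pi_pos]
    have := (Real.cos_eq_one_iff_of_lt_of_lt (by linarith) hlt).1 h
    linarith
  have key := NewtonCert.energy_ge_hasSum_of_pow (n := 2) N (N / 2) (fun i => node N i - 1) (mult N) ht C h1
    (fun k => by
      have h := ckPow_energy_ge hN k C h1 hC
      rw [← sum_mult_node hN (fun s => (1 + s) ^ k)] at h
      exact h) a c hc ha
  rw [sum_mult_node hN a] at key
  exact key

open scoped Classical in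
/-- **Theorem C** (regular `N`-gon, Cohn–Kumar Thm. 1.2 verbatim for `S¹`): for every `N ≥ 2` and every `a`
absolutely monotonic on `[-1,1)`, every `N`-point configuration of unit vectors of `ℝ²` has `a`-energy at least
`N Σ_{l=1}^{N-1} a(cos(2πl/N))`, the energy of the regular `N`-gon. [cite: CohnKumar2006, Theorem 1.2] -/
theorem universallyOptimal_of_absolutelyMonotoneOn {N : ℕ} (hN : 2 ≤ N) (a : ℝ → ℝ)
    (ha : AbsolutelyMonotoneOn a (Set.Ico (-1) 1))
    (C : Finset (EuclideanSpace ℝ (Fin 2))) (h1 : ∀ x ∈ C, ‖x‖ = 1) (hC : C.card = N) :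
    (N : ℝ) * ∑ l ∈ range (N - 1), a (Real.cos (2 * Real.pi * ((l + 1 : ℕ) : ℝ) / N)) ≤
      ∑ x ∈ C, ∑ y ∈ C.erase x, a (inner ℝ x y) := by
  obtain ⟨c, hc, hsum⟩ := absolutelyMonotoneOn_hasSum_one_add ha
  exact universally_optimal hN a c hc hsum C h1 hC

end UniversalPolygon

end Summit.Ventures.PackingBounds.Energy

end
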